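import Mathlib
import Summits.ValiantsHypothesis.ValiantsHypothesis.Theses.RigidityForcesSymmetry
import Literature.Computability.AlgebraicComplexity.LandsbergRessayreThm21Proofs

/-!
# Border apolarity, crux `ToricWitnessObstructionQP` (stmt-ValiantsHypothesis-14753) — line `Sketch`,
# reshape 5: stub `stub_torusBound` (= `RigidityForcesSymmetry.TorusBound`, stmt-ValiantsHypothesis-4164)

Route `ValiantsHypothesis/BorderApolarity`, crux `stmt-ValiantsHypothesis-14753`, line `Sketch`, reshape 5.
Convention of the tree's LR17 files: `m` = size of the permanent, `n` = size of the matrix.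

**Statement.** For `m ≥ 3`, every affine determinantal representation `Ã = Λ + Σ x_{kj} A_{kj}` of
`perm_m` over `ℂ` (size `n`) which is equivariant with EXACT lifts (`IsEquivariantDetRepr`) for the
two-sided torus `x_{kj} ↦ d_k e_j x_{kj}` has `2 ^ m - 1 ≤ n` — Landsberg–Ressayre 2017 Thm. 2.8
WITHOUT the Weyl group `𝔖_m` but WITH the right torus.

**Proof.** ONE generic torus element `t = diag(p) ⊗ diag(q)` (`p ⊔ q = primes₂ m`, `2m` distinct
primes) with ONE exact lift `(P, Q)` (`P Λ = Λ Q`, `P A_{kj} = p_k q_j A_{kj} Q`): regularity (von zur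
Gathen, a tree theorem) makes `ker Λ` a `Q`-line of weight `γ₀ ≠ 0`, and the top weight of `P` on
`ℂⁿ / range Λ` is the character `(∏ p ∏ q) γ₀` (`LRLiftCharacter`).  The new point (replacing LR's use of
permutation lifts): for EVERY `σ ∈ 𝔖_m` the pencil ON THE GRAPH OF `σ`,
`Λ + Σ_k x_{k σ(k)} A_{k σ(k)}` (all other coefficient matrices replaced by `0`), is again a two-sided
torus datum (`TorusData₂`) with the SAME lift, the same kernel weight and the same top weight, and with
an injective member (`Ã` at the permutation matrix of `σ`, of determinant `perm_m(P_σ) = 1`); so the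
tree's two-sided chain (`good_one`, `exists_good_profile`) produces good `0/1` exponents of every row
degree `1 ≤ s ≤ m`, and since only the steps `st k (σ k)` are available their columns are `σ` of their
rows (`torusBound_good_graph`, a closure argument).  Hence for every `σ` and every `1 ≤ s ≤ m` some
weight `γ₀ ∏_{k ∈ I} p_k q_{σ k}` (`|I| = s`) of `P` occurs (`torusBound_served`).  The count
(`torusBound_levelCount`): a pair `(I, J)` serves only the `s!(m-s)!` permutations with `σ(I) = J`, so
level `s` carries `≥ C(m,s)` pairs with distinct weights (unique factorisation) and independent
generalised eigenspaces, whence `n ≥ Σ_{s=1}^m C(m,s) = 2^m - 1`.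
-/

open Matrix MvPolynomial Finset Module.End
open scoped Kronecker
open Literature.Computability.AlgebraicComplexity LRPencil

-- the mandated summit-side namespace repeats a component by design (single-problem summit)
set_option linter.dupNamespace false

namespace Summit.ValiantsHypothesis.ValiantsHypothesis.Theorems.BorderApolarityToricWitnessObstructionQP

noncomputable section

/-! ### §1 Counting permutations mapping `I` onto `J` -/

/-- At most `|I|! (m - |I|)!` permutations of `[m]` map `I` onto `J` (restriction to `I` and to its
complement is injective into `(I ≃ J) × (Iᶜ ≃ Jᶜ)`). [folklore] -/
theorem torusBound_card_perm_map_le {m : ℕ} (I J : Finset (Fin m)) :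
    (univ.filter fun σ : Equiv.Perm (Fin m) => I.map σ.toEmbedding = J).card ≤
      I.card.factorial * (m - I.card).factorial := by
  classical
  by_cases hne : (univ.filter fun σ : Equiv.Perm (Fin m) => I.map σ.toEmbedding = J) = ∅
  · rw [hne, card_empty]; exact Nat.zero_le _
  obtain ⟨τ, hτ⟩ := nonempty_iff_ne_empty.2 hne
  rw [mem_filter] at hτ
  have hIJ : I.card = J.card := by rw [← hτ.2, card_map]
  have key : ∀ σ : Equiv.Perm (Fin m), I.map σ.toEmbedding = J → ∀ a, a ∈ I ↔ σ a ∈ J := by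
    intro σ hσ a
    rw [← hσ, mem_map_equiv, Equiv.symm_apply_apply]
  let S := {σ : Equiv.Perm (Fin m) // I.map σ.toEmbedding = J}
  let F : S → (↥I ≃ ↥J) × ({a // a ∉ I} ≃ {b // b ∉ J}) := fun σ =>
    (σ.1.subtypeEquiv (fun a => key σ.1 σ.2 a), σ.1.subtypeEquiv (fun a => not_congr (key σ.1 σ.2 a)))
  have hF : Function.Injective F := by
    rintro ⟨σ, hσ⟩ ⟨σ', hσ'⟩ h
    simp only [Prod.mk.injEq, F] at h
    apply Subtype.ext
    refine Equiv.ext fun a => ?_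
    by_cases ha : a ∈ I
    · have := congrArg (fun e : ↥I ≃ ↥J => ((e ⟨a, ha⟩ : ↥J) : Fin m)) h.1
      simpa using this
    · have := congrArg (fun e : {a // a ∉ I} ≃ {b // b ∉ J} => ((e ⟨a, ha⟩ : {b // b ∉ J}) : Fin m)) h.2
      simpa using this
  have eI : ↥I ≃ ↥J := Finset.equivOfCardEq hIJ
  have eIc : {a // a ∉ I} ≃ {b // b ∉ J} := Fintype.equivOfCardEq (by
    rw [Fintype.card_subtype_compl, Fintype.card_subtype_compl, Fintype.card_coe, Fintype.card_coe,
      hIJ])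
  calc (univ.filter fun σ : Equiv.Perm (Fin m) => I.map σ.toEmbedding = J).card
      = Fintype.card S := (Fintype.card_subtype _).symm
    _ ≤ Fintype.card ((↥I ≃ ↥J) × ({a // a ∉ I} ≃ {b // b ∉ J})) :=
        Fintype.card_le_of_injective F hF
    _ = I.card.factorial * (m - I.card).factorial := by
        rw [Fintype.card_prod, Fintype.card_equiv eI, Fintype.card_equiv eIc, Fintype.card_coe,
          Fintype.card_subtype_compl, Fintype.card_coe, Fintype.card_fin]

/-! ### §2 The graded pigeonhole: served weights force `2 ^ m - 1 ≤ dim V` -/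

/-- **The count** (LR17 §6, last page, without the Weyl group): let `B` be an endomorphism of a
finite-dimensional `V` and `wt (I, J)` an injective family of scalars indexed by pairs of subsets of
`[m]`.  If for every `σ ∈ 𝔖_m` and every `1 ≤ s ≤ m` some pair `(I, σ(I))` with `|I| = s` has a
non-zero generalised eigenspace `E (wt (I, σ I))`, then `2 ^ m - 1 ≤ dim V`: a pair `(I, J)` serves only
the `s!(m-s)!` permutations with `σ(I) = J`, so level `s` carries `≥ C(m, s)` present pairs
(pigeonhole over `𝔖_m`), present pairs have independent non-zero eigenspaces, and
`Σ_{s=1}^m C(m,s) = 2^m - 1`. [cite: LandsbergRessayre2017, §6] -/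
theorem torusBound_levelCount {V : Type*} [AddCommGroup V] [Module ℂ V] [FiniteDimensional ℂ V]
    (B : Module.End ℂ V) {m : ℕ} (wt : Finset (Fin m) → Finset (Fin m) → ℂ)
    (hwt : ∀ I J I' J', wt I J = wt I' J' → I = I' ∧ J = J')
    (hserved : ∀ σ : Equiv.Perm (Fin m), ∀ s, 1 ≤ s → s ≤ m →
      ∃ I : Finset (Fin m), I.card = s ∧ B.maxGenEigenspace (wt I (I.map σ.toEmbedding)) ≠ ⊥) :
    2 ^ m - 1 ≤ Module.finrank ℂ V := by
  classical
  -- the present pairs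
  set W : Finset (Finset (Fin m) × Finset (Fin m)) :=
    univ.filter fun IJ => B.maxGenEigenspace (wt IJ.1 IJ.2) ≠ ⊥ with hW
  -- (1) present pairs have independent non-zero eigenspaces: `|W| ≤ dim V`
  have h1 : W.card ≤ Module.finrank ℂ V := by
    let g : ↥W → ℂ := fun IJ => wt IJ.1.1 IJ.1.2
    have hg : Function.Injective g := by
      rintro ⟨⟨I, J⟩, hIJ⟩ ⟨⟨I', J'⟩, hIJ'⟩ h
      obtain ⟨rfl, rfl⟩ := hwt I J I' J' h
      rfl
    have hind : iSupIndep (fun IJ : ↥W => B.maxGenEigenspace (g IJ)) :=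
      B.independent_maxGenEigenspace.comp hg
    have hne : ∀ IJ : ↥W, (fun IJ : ↥W => B.maxGenEigenspace (g IJ)) IJ ≠ ⊥ := fun IJ =>
      (mem_filter.1 IJ.2).2
    have := hind.subtype_ne_bot_le_finrank
    rwa [Fintype.card_congr (Equiv.subtypeUnivEquiv hne), Fintype.card_coe] at this
  -- (2) level `s` carries at least `C(m, s)` present pairs
  have h2 : ∀ s, 1 ≤ s → s ≤ m → m.choose s ≤ (W.filter fun IJ => IJ.1.card = s).card := by
    intro s hs1 hsm
    choose I hI hE using fun σ : Equiv.Perm (Fin m) => hserved σ s hs1 hsm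
    set T := W.filter fun IJ => IJ.1.card = s with hT
    let f : Equiv.Perm (Fin m) → Finset (Fin m) × Finset (Fin m) := fun σ =>
      (I σ, (I σ).map σ.toEmbedding)
    have hf : ∀ σ ∈ (univ : Finset (Equiv.Perm (Fin m))), f σ ∈ T := fun σ _ => by
      simp only [hT, hW, mem_filter, mem_univ, true_and, f]
      exact ⟨hE σ, hI σ⟩
    have hfib : ∀ b ∈ T, (univ.filter fun σ => f σ = b).card ≤ s.factorial * (m - s).factorial := by
      rintro ⟨I₀, J₀⟩ hb
      have hI₀ : I₀.card = s := (mem_filter.1 hb).2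
      calc (univ.filter fun σ => f σ = (I₀, J₀)).card
          ≤ (univ.filter fun σ : Equiv.Perm (Fin m) => I₀.map σ.toEmbedding = J₀).card := by
            refine card_le_card fun σ hσ => ?_
            simp only [mem_filter, mem_univ, true_and, f, Prod.mk.injEq] at hσ ⊢
            rw [← hσ.1]
            exact hσ.2
        _ ≤ s.factorial * (m - s).factorial := by
            rw [← hI₀]; exact torusBound_card_perm_map_le I₀ J₀
    have hcount := card_le_mul_card_image_of_maps_to hf _ hfib
    rw [card_univ, Fintype.card_perm, Fintype.card_fin] at hcount
    refine Nat.le_of_mul_le_mul_right ?_ (Nat.mul_pos (Nat.factorial_pos s) (Nat.factorial_pos (m - s)))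
    calc m.choose s * (s.factorial * (m - s).factorial) = m.factorial := by
          rw [← mul_assoc, Nat.choose_mul_factorial_mul_factorial hsm]
      _ ≤ s.factorial * (m - s).factorial * T.card := hcount
      _ = T.card * (s.factorial * (m - s).factorial) := mul_comm _ _
  -- (3) sum over the levels `s = 1, …, m`
  have h3 : W.card = ∑ s ∈ range (m + 1), (W.filter fun IJ => IJ.1.card = s).card :=
    card_eq_sum_card_fiberwise (f := fun IJ : Finset (Fin m) × Finset (Fin m) => IJ.1.card)
      fun IJ _ => mem_range_succ_iff.2 (card_finset_fin_le IJ.1)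
  have h4 : 2 ^ m ≤ W.card + 1 := by
    rw [← Nat.sum_range_choose m, h3]
    have : ∑ s ∈ range (m + 1), (W.filter fun IJ => IJ.1.card = s).card + 1 =
        ∑ s ∈ range (m + 1), ((W.filter fun IJ => IJ.1.card = s).card + if s = 0 then 1 else 0) := by
      rw [sum_add_distrib, sum_ite_eq']
      simp
    rw [this]
    refine sum_le_sum fun s hs => ?_
    rcases Nat.eq_zero_or_pos s with rfl | hs1
    · simp
    · rw [if_neg (by omega), add_zero]
      exact h2 s hs1 (by rw [mem_range] at hs; omega)
  omega

/-! ### §3 A two-sided torus datum supported on the graph of a permutation -/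

/-- **Weights on the graph of `σ`.**  Let `D` be a two-sided torus datum whose coefficient maps
vanish off the graph of `σ` (`A_{kj} = 0` unless `j = σ k`).  Then every GOOD exponent `w` (a weight
`wt w` of the canonical subspace `𝒫_{[m] ⊔ [m]}`) has its column multiplicities equal to its row
multiplicities transported by `σ`: `w (inr (σ k)) = w (inl k)`.  Indeed the sum of the weight spaces
`E (wt w')` over all such `w'` is closed under every `A_{k, σ k} ∘ Λ⁻¹` (one step of the chain adds
`st k (σ k)`), hence contains `𝒫_{[m] ⊔ [m]}`, and distinct exponents have distinct weights.
[cite: LandsbergRessayre2017, §6] -/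
theorem torusBound_good_graph {V : Type*} [AddCommGroup V] [Module ℂ V] [FiniteDimensional ℂ V]
    {m : ℕ} (D : TorusData₂ m V) (σ : Equiv.Perm (Fin m)) (hA : ∀ k j, j ≠ σ k → D.A k j = 0)
    {w : Fin m ⊕ Fin m → ℕ} (hw : D.Good w) : ∀ k, w (Sum.inr (σ k)) = w (Sum.inl k) := by
  classical
  let Wσ := {w : Fin m ⊕ Fin m → ℕ // ∀ k, w (Sum.inr (σ k)) = w (Sum.inl k)}
  have hst : ∀ (w : Wσ) (k k' : Fin m),
      (w.1 + st k (σ k)) (Sum.inr (σ k')) = (w.1 + st k (σ k)) (Sum.inl k') := by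
    intro w k k'
    simp only [Pi.add_apply, w.2 k', st_apply, Sum.inr.injEq, Sum.inl.injEq, σ.apply_eq_iff_eq,
      reduceCtorEq, if_false, zero_add, add_zero]
  set G : Submodule ℂ V := ⨆ w : Wσ, D.E (D.wt w.1) with hG
  have hGst : G.map D.B ≤ G := by
    rw [hG, Submodule.map_iSup]; exact iSup_mono fun w => D.map_E_le _
  have hclosed : IsClosedUnder₂ D.Λ D.A univ G := by
    intro k j _ _
    by_cases hj : j = σ k
    · subst hj
      refine (Submodule.map_mono (D.comap_le_iSup_sup_ker (fun w : Wσ => D.wt w.1) hGst le_rfl)).trans ?_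
      rw [Submodule.map_sup, Submodule.map_iSup]
      refine sup_le (iSup_le fun w => ?_) ?_
      · calc ((G ⊓ D.E (D.wt w.1)).comap D.Λ ⊓ D.F (D.wt w.1)).map (D.A k (σ k))
            ≤ (D.F (D.wt w.1)).map (D.A k (σ k)) := Submodule.map_mono inf_le_right
          _ ≤ D.E (D.wt (w.1 + st k (σ k))) := D.map_A_F_wt_le k (σ k) w.1
          _ ≤ G := le_iSup (fun w : Wσ => D.E (D.wt w.1)) ⟨w.1 + st k (σ k), hst w k⟩
      · calc (LinearMap.ker D.Λ).map (D.A k (σ k)) ≤ D.E (D.wt (0 + st k (σ k))) := D.map_A_ker_le k (σ k)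
          _ ≤ G := le_iSup (fun w : Wσ => D.E (D.wt w.1))
              ⟨(0 : Fin m ⊕ Fin m → ℕ) + st k (σ k), hst ⟨0, fun _ => rfl⟩ k⟩
    · rw [hA k j hj, Submodule.map_zero]; exact bot_le
  have hcanon : canon₂ D.Λ D.A univ ≤ G := canon₂_le hclosed
  by_contra hne
  apply hw.2
  rw [eq_bot_iff]
  calc canon₂ D.Λ D.A univ ⊓ D.E (D.wt w) ≤ G ⊓ D.E (D.wt w) := inf_le_inf_right _ hcanon
    _ = ⊥ := iSup_maxGen_inf_eq_bot _ (fun w' : Wσ => D.wt w'.1) fun w' h =>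
        hne (by rw [← D.wt_injective h]; exact w'.2)

/-- The `0/1` exponent of a pair `(I, J)` (`1` on the rows in `I` and on the columns in `J`)
determines the pair. [folklore] -/
theorem torusBound_ind_injective {m : ℕ} {I J I' J' : Finset (Fin m)}
    (h : (Sum.elim (fun k => if k ∈ I then 1 else 0) (fun j => if j ∈ J then 1 else 0) :
        Fin m ⊕ Fin m → ℕ) =
      Sum.elim (fun k => if k ∈ I' then 1 else 0) (fun j => if j ∈ J' then 1 else 0)) :
    I = I' ∧ J = J' := by
  constructor
  · ext k
    have h1 := congrFun h (Sum.inl k)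
    simp only [Sum.elim_inl] at h1
    by_cases ha : k ∈ I <;> by_cases hb : k ∈ I' <;> simp_all
  · ext j
    have h1 := congrFun h (Sum.inr j)
    simp only [Sum.elim_inr] at h1
    by_cases ha : j ∈ J <;> by_cases hb : j ∈ J' <;> simp_all

/-- **Every level is served on the graph of `σ`.**  For a two-sided torus datum supported on the
graph of `σ` whose top exponent `(1, …, 1; 1, …, 1)` is good, and every `1 ≤ s ≤ m`, there is an
`s`-set `I` of rows such that `wt (I, σ I) = γ₀ ∏_{k ∈ I} p_k q_{σ k}` is a weight of `B`: descend
from the top by the tree's two-sided chain (`exists_good_profile`) to a good `0/1` exponent of row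
degree `s`; by `torusBound_good_graph` its columns are `σ` of its rows. [cite: LandsbergRessayre2017, §6] -/
theorem torusBound_served {V : Type*} [AddCommGroup V] [Module ℂ V] [FiniteDimensional ℂ V]
    {m : ℕ} (D : TorusData₂ m V) (σ : Equiv.Perm (Fin m)) (hA : ∀ k j, j ≠ σ k → D.A k j = 0)
    (hgood : D.Good (fun _ => 1)) (s : ℕ) (hs1 : 1 ≤ s) (hsm : s ≤ m) :
    ∃ I : Finset (Fin m), I.card = s ∧
      D.E (D.wt (Sum.elim (fun k => if k ∈ I then 1 else 0)
        (fun j => if j ∈ I.map σ.toEmbedding then 1 else 0))) ≠ ⊥ := by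
  classical
  obtain ⟨w, hw, hw1, hr, -⟩ := D.exists_good_profile hgood (m - s) (by omega)
  have hgr := torusBound_good_graph D σ hA hw
  refine ⟨TorusData₂.rows w, ?_, ?_⟩
  · rw [TorusData₂.card_rows_eq hw1, hr]; omega
  · have hwI : w = Sum.elim (fun k => if k ∈ TorusData₂.rows w then 1 else 0)
        (fun j => if j ∈ (TorusData₂.rows w).map σ.toEmbedding then 1 else 0) := by
      funext x
      rcases x with k | j
      · simp only [Sum.elim_inl, TorusData₂.rows, mem_filter, mem_univ, true_and]
        have := hw1 (Sum.inl k)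
        by_cases h0 : w (Sum.inl k) = 0
        · simp [h0]
        · rw [if_pos h0]; omega
      · obtain ⟨k, rfl⟩ := σ.surjective j
        simp only [Sum.elim_inr, mem_map_equiv, Equiv.symm_apply_apply, TorusData₂.rows, mem_filter,
          mem_univ, true_and]
        rw [hgr k]
        have := hw1 (Sum.inl k)
        by_cases h0 : w (Sum.inl k) = 0
        · simp [h0]
        · rw [if_pos h0]; omega
    rw [← hwI]
    exact fun h => hw.2 (by rw [eq_bot_iff, ← h]; exact inf_le_right)

/-! ### §4 The stub -/

/-- **`TorusBound` (stmt-ValiantsHypothesis-4164; LR17 Thm. 2.8 without the Weyl group, with the right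
torus).**  For `m ≥ 3`, a two-sided-torus-equivariant (exact lifts) affine determinantal representation
of `perm_m` over `ℂ` has size `n ≥ 2 ^ m - 1`.  Proof: regularity (von zur Gathen 1987 Thm. 3.1, a tree
theorem); one generic torus element `diag(p) ⊗ diag(q)` (`2m` distinct primes), a generator of the
two-sided torus, and its exact lift `(P, Q)`; the kernel weight `γ₀ ≠ 0` of `Q` and the top weight
`(∏ p ∏ q) γ₀` of `P` (`LRLiftCharacter`); for each `σ ∈ 𝔖_m` the torus datum ON THE GRAPH of `σ` (same
lift, injective member `Ã(P_σ)`), whose good exponents of every row degree have columns `σ`(rows)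
(`torusBound_served`); and the graded pigeonhole `torusBound_levelCount`.
[cite: LandsbergRessayre2017, Thm. 2.8, §6] [cite: Vonzurgathen1987, Thm. 3.1] -/
theorem stub_torusBound : Summit.ValiantsHypothesis.ValiantsHypothesis.Theses.RigidityForcesSymmetry.TorusBound := by
  intro m hm n A hA
  classical
  have haff : ∀ r c, (A r c).totalDegree ≤ 1 := hA.1.1
  have hdet : A.det = perPoly (Fin m) ℂ := hA.1.2
  have hn : 0 < n := pos_of_det_eq_perPoly (by omega) hdet
  have hreg : IsRegularDetRepr (perPoly (Fin m) ℂ) A :=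
    hA.isRegular_perPoly vonzurGathen1987_perm_detRepr_rank_holds hm
  have hrank : (constPart A).rank = n - 1 := hreg.2
  set Λm : Matrix (Fin n) (Fin n) ℂ := constPart A with hΛm
  -- (1) `2m` distinct primes: rows `d`, columns `e`
  set r : Fin m ⊕ Fin m → ℕ := primes₂ m with hr
  set d : Fin m → ℂ := fun k => (r (Sum.inl k) : ℂ) with hd
  set e : Fin m → ℂ := fun j => (r (Sum.inr j) : ℂ) with he
  have hd0 : ∀ i, d i ≠ 0 := fun i => primes₂_cast_ne_zero m _
  have he0 : ∀ i, e i ≠ 0 := fun i => primes₂_cast_ne_zero m _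
  have hc : ∀ x : Fin m ⊕ Fin m, ((fun x => (r x : ℂ)) x) ≠ 0 := fun x => primes₂_cast_ne_zero m x
  -- (2) the torus element `diag(d) ⊗ diag(e) = diag(d_k e_j)` is a generator of the two-sided torus
  let γ : GL (Fin m × Fin m) ℂ :=
    Matrix.GeneralLinearGroup.kronecker (diagUnit ℂ d hd0) (diagUnit ℂ e he0)
  have hγcoe : (γ : Matrix (Fin m × Fin m) (Fin m × Fin m) ℂ) = Matrix.diagonal d ⊗ₖ Matrix.diagonal e :=
    coe_kronecker_diagUnit d e hd0 he0
  have hγmem : γ ∈ Subgroup.closure {γ : GL (Fin m × Fin m) ℂ | ∃ d e : Fin m → ℂ,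
      (γ : Matrix (Fin m × Fin m) (Fin m × Fin m) ℂ) = Matrix.diagonal (fun p => d p.1 * e p.2)} :=
    Subgroup.subset_closure ⟨d, e, by rw [hγcoe, Matrix.diagonal_kronecker_diagonal]⟩
  -- (3) its exact lift `(P, Q)`: `P Λ = Λ Q`, `P A_{kj} = d_k e_j A_{kj} Q`
  obtain ⟨P, Q, hPQ, hΛ⟩ := hA.exists_lift_stabilising hγmem
  have hkj : ∀ k j, (P : Matrix (Fin n) (Fin n) ℂ) * coeffMat A (k, j) =
      (d k * e j) • (coeffMat A (k, j) * (Q : Matrix (Fin n) (Fin n) ℂ)) := by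
    intro k j
    have e1 : coeffMat (Matrix.linSubstEntries γ A) (k, j) =
        coeffMat ((P : Matrix (Fin n) (Fin n) ℂ).map C * A *
          ((Q⁻¹ : GL (Fin n) ℂ) : Matrix (Fin n) (Fin n) ℂ).map C) (k, j) := by rw [hPQ]
    rw [coeffMat_linSubstEntries _ _ haff, hγcoe, sum_kron_diagonal_diagonal_smul,
      coeffMat_C_mul_mul_C] at e1
    rw [mul_eq_of_eq_mul_mul_inv e1, Matrix.smul_mul]
  -- (4) regularity: `ker Λ` is a line on which `Q` has the weight `γ₀ ≠ 0`; the top weight of `P`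
  let L₀ : Lift₂ (Matrix.toLin' Λm) (fun k j => Matrix.toLin' (coeffMat A (k, j))) 1 1
      (fun x => (r x : ℂ)) :=
    lift₂OfMatrices Λm (fun k j => coeffMat A (k, j)) 1 1 _ hc P Q hΛ (fun k j => hkj k j)
  have hK : Module.finrank ℂ (LinearMap.ker (Matrix.toLin' Λm)) = 1 :=
    finrank_ker_toLin'_eq_one hn hrank
  obtain ⟨γ₀, hγ₀, hker⟩ := exists_eigenvalue_of_finrank_ker_eq_one _ L₀.C L₀.map_ker_eq hK
  have htop := maxGenEigenspace_le_range_of_ne_character hn hdet hrank hγcoe hPQ hker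
  -- (5) for each `σ`: the datum on the graph of `σ` serves every level
  let ind : Finset (Fin m) → Finset (Fin m) → Fin m ⊕ Fin m → ℕ := fun I J =>
    Sum.elim (fun k => if k ∈ I then 1 else 0) (fun j => if j ∈ J then 1 else 0)
  have hserved : ∀ σ : Equiv.Perm (Fin m), ∀ s, 1 ≤ s → s ≤ m → ∃ I : Finset (Fin m), I.card = s ∧
      maxGenEigenspace (Matrix.toLin' (P : Matrix (Fin n) (Fin n) ℂ))
        (γ₀ * ∏ x, (r x : ℂ) ^ ind I (I.map σ.toEmbedding) x) ≠ ⊥ := by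
    intro σ s hs1 hsm
    let Am : Fin m → Fin m → Matrix (Fin n) (Fin n) ℂ := fun k j =>
      if j = σ k then coeffMat A (k, j) else 0
    have hkj' : ∀ k j, (P : Matrix (Fin n) (Fin n) ℂ) * Am k j =
        ((fun x => (r x : ℂ)) (Sum.inl k) * (fun x => (r x : ℂ)) (Sum.inr j)) •
          (Am ((1 : Equiv.Perm (Fin m)) k) ((1 : Equiv.Perm (Fin m)) j) *
            (Q : Matrix (Fin n) (Fin n) ℂ)) := by
      intro k j
      show (P : Matrix (Fin n) (Fin n) ℂ) * Am k j = (d k * e j) • (Am k j * (Q : Matrix (Fin n) (Fin n) ℂ))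
      by_cases hj : j = σ k
      · simp only [Am, if_pos hj]; exact hkj k j
      · simp only [Am, if_neg hj, Matrix.mul_zero, Matrix.zero_mul, smul_zero]
    let L : Lift₂ (Matrix.toLin' Λm) (fun k j => Matrix.toLin' (Am k j)) 1 1 (fun x => (r x : ℂ)) :=
      lift₂OfMatrices Λm Am 1 1 _ hc P Q hΛ hkj'
    let D : TorusData₂ m (Fin n → ℂ) :=
      { Λ := Matrix.toLin' Λm, A := fun k j => Matrix.toLin' (Am k j), r := r,
        prime := primes₂_prime m, r_inj := primes₂_injective m, L := L, γ₀ := γ₀, ker_le := hker,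
        γ₀_ne := hγ₀ }
    have hAσ : ∀ k j, j ≠ σ k → D.A k j = 0 := fun k j hj => by
      show Matrix.toLin' (Am k j) = 0
      simp only [Am, if_neg hj, map_zero]
    -- an injective member: `Ã` at the permutation matrix of `σ`, of determinant `perm_m(P_σ) = 1`
    have hgen : ∃ x : Fin m → Fin m → ℂ, Function.Injective (D.Λ + ∑ k, ∑ j, x k j • D.A k j) := by
      let v : Fin m × Fin m → ℂ := fun w => if w.2 = σ w.1 then 1 else 0
      refine ⟨fun k j => v (k, j), ?_⟩
      have hmat : D.Λ + ∑ k, ∑ j, v (k, j) • D.A k j = Matrix.toLin' (A.map (MvPolynomial.eval v)) := by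
        show Matrix.toLin' Λm + ∑ k, ∑ j, v (k, j) • Matrix.toLin' (Am k j) = _
        rw [map_eval_eq A haff v, map_add, map_sum, Fintype.sum_prod_type]
        simp only [map_smul]
        congr 1
        refine Finset.sum_congr rfl fun k _ => Finset.sum_congr rfl fun j _ => ?_
        by_cases hj : j = σ k
        · simp only [Am, if_pos hj]
        · simp only [Am, v, if_neg hj, zero_smul]
      have hdetv : (A.map (MvPolynomial.eval v)).det ≠ 0 := by
        have e2 : (A.map (MvPolynomial.eval v)).det = MvPolynomial.eval v A.det := by
          rw [RingHom.map_det]; rfl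
        rw [e2, hdet, eval_perPoly]
        have hv1 : (Matrix.of fun i j : Fin m => v (i, j)) = (1 : Matrix (Fin m) (Fin m) ℂ).submatrix σ id := by
          ext i j
          simp only [Matrix.of_apply, Matrix.submatrix_apply, id_eq, Matrix.one_apply, v, eq_comm]
        rw [hv1, Matrix.permanent_permute_cols, Matrix.permanent_one]
        exact one_ne_zero
      rw [hmat]
      have hunit : IsUnit (A.map (MvPolynomial.eval v)) :=
        (Matrix.isUnit_iff_isUnit_det _).2 (isUnit_iff_ne_zero.2 hdetv)
      intro x y hxy
      apply Matrix.mulVec_injective_iff_isUnit.2 hunit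
      simpa [Matrix.toLin'_apply] using hxy
    -- the top weight is `wt 1`
    have htop' : ∀ β, β ≠ D.wt (fun _ => 1) → D.E β ≤ LinearMap.range D.Λ := by
      have hwt : D.wt (fun _ => 1) = ((∏ k, d k) * ∏ j, e j) * γ₀ := by
        show γ₀ * ∏ x, (r x : ℂ) ^ (fun _ : Fin m ⊕ Fin m => 1) x = ((∏ k, d k) * ∏ j, e j) * γ₀
        simp only [pow_one]
        rw [Fintype.prod_sum_type, mul_comm]
      intro β hβ
      rw [hwt] at hβ
      exact htop β hβ
    have hgood : D.Good (fun _ => 1) := D.good_one hK hgen htop'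
    obtain ⟨I, hI, hE⟩ := torusBound_served D σ hAσ hgood s hs1 hsm
    exact ⟨I, hI, hE⟩
  -- (6) the count
  have hwt_inj : ∀ I J I' J' : Finset (Fin m),
      (γ₀ * ∏ x, (r x : ℂ) ^ ind I J x) = γ₀ * ∏ x, (r x : ℂ) ^ ind I' J' x → I = I' ∧ J = J' := by
    intro I J I' J' h
    have h' : (∏ x, (r x : ℂ) ^ ind I J x) = ∏ x, (r x : ℂ) ^ ind I' J' x := mul_left_cancel₀ hγ₀ h
    have h'' : (∏ x, r x ^ ind I J x) = ∏ x, r x ^ ind I' J' x := by exact_mod_cast h'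
    exact torusBound_ind_injective
      (eq_of_prod_prime_pow_eq_fintype (primes₂_prime m) (primes₂_injective m) h'')
  have hmain := torusBound_levelCount (Matrix.toLin' (P : Matrix (Fin n) (Fin n) ℂ))
    (fun I J => γ₀ * ∏ x, (r x : ℂ) ^ ind I J x) hwt_inj hserved
  rwa [Module.finrank_fin_fun] at hmain

end

end Summit.ValiantsHypothesis.ValiantsHypothesis.Theorems.BorderApolarityToricWitnessObstructionQP
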